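import Literature.Computability.Cryptography.SphericalCapMeasure
import Mathlib.Analysis.SpecialFunctions.Trigonometric.Basic
import HarnessLib

/-!
# The popcount (XOR-sketch) filter of Albrecht–Gheorghiu–Postlethwaite–Schanck 2020, §5: pass probability `P_{k,n}(θ)`,
# the sphere-averaged pass probability (eq. 4) and the false-negative rate in a neighbourhood (eq. 5)

Verbatim typed DEFINITIONS from [AlbrechtEtAl2020QuantumSieves] (ASIACRYPT 2020, LNCS 12492), §5 "The Accuracy of popcount",
p. 596, built on the §2 cap quantities `capRatio` (`C_d`) and `capDensity` (`A_d`) of `SphericalCapMeasure.lean`: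

* `popcountPass k n θ` — printed: "The hyperplane defined by `h_i` separates `u` and `v` with probability `θ(u,v)/π`, and
  `popcount_{k,n}(u,v;h) = 0` if no more than `k` of the hyperplanes separate `u` and `v`. Hence
  `P_{k,n}(u,v) = Σ_{i=0}^{k} C(n,i)·(θ(u,v)/π)^i·(1 − θ(u,v)/π)^{n−i}`. Note that `P_{k,n}(u,v)` depends only on the angle
  between `u` and `v`, so it makes sense to define `P_{k,n}(θ)`."
* `passProbUpTo d k n φ` — the display `∫₀^φ P_{k,n}(θ)·A_d(θ) dθ`: with `φ = π` this is eq. (4), `Pr[P̂_{k,n}] = ∫₀^π P_{k,n}(θ)·A_d(θ) dθ`;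
  with a general upper limit it is `Pr[P̂_{k,n} ∧ R̂_φ]` ("can be calculated by changing the upper limit of integration in Eq. 4").
* `falseNegativeRate d k n φ` — eq. (5): "`1 − Pr[P̂_{k,n} | R̂_φ] = 1 − (1/C_d(φ))·∫₀^φ P_{k,n}(θ)·A_d(θ) dθ`".

The paper flags the standing heuristic itself (p. 596: "The main heuristic in our analysis of popcount is that `P_{k,n}(u,v)` is a
good approximation to the probability that `popcount_{k,n}(u,v;h) = 0` for fixed `h` and varying `u` and `v`"); nothing here asserts
it — these are the printed right-hand sides as real functions, plus three elementary API facts (`P_{k,n}(0) = 1`, `0 ≤ P_{k,n} ≤ 1`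
on `[0, π]`). The cap-restricted variants (eqs. (6), (7), wedge `W_d`) are not typed here (their integral representation is in the
paper's full version, App. A). Users: the `Ventures/LatticeEstimator` cell (interval evaluation of the §6 cost formulas).

## References
* [AlbrechtEtAl2020QuantumSieves] M. R. Albrecht, V. Gheorghiu, E. W. Postlethwaite, J. M. Schanck, *Estimating quantum speedups
  for lattice sieves*, ASIACRYPT 2020, LNCS 12492, pp. 583–613, §5 p. 596 (eqs. (4), (5)).
-/

noncomputable section

open Finset

namespace Literature.Computability.Cryptography.AGPS20

/-- The popcount pass probability `P_{k,n}(θ) = Σ_{i=0}^{k} C(n,i)·(θ/π)^i·(1 − θ/π)^{n−i}` for a pair at angle `θ`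
(`n` random hyperplanes, threshold `k`). [cite: AlbrechtEtAl2020QuantumSieves, §5 p. 596, display defining `P_{k,n}(u,v)`] -/
def popcountPass (k n : ℕ) (θ : ℝ) : ℝ :=
  ∑ i ∈ range (k + 1), (n.choose i : ℝ) * (θ / Real.pi) ^ i * (1 - θ / Real.pi) ^ (n - i)

/-- `∫₀^φ P_{k,n}(θ)·A_d(θ) dθ` — for `φ = π` the sphere-averaged pass probability `Pr[P̂_{k,n}]` of eq. (4), for general `φ`
the joint probability `Pr[P̂_{k,n} ∧ R̂_φ]`. [cite: AlbrechtEtAl2020QuantumSieves, §5 p. 596, eq. (4) and the sentence after it] -/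
def passProbUpTo (d k n : ℕ) (φ : ℝ) : ℝ :=
  ∫ θ in (0 : ℝ)..φ, popcountPass k n θ * capDensity d θ

/-- The false-negative rate for neighbours at angle `≤ φ`: `1 − (1/C_d(φ))·∫₀^φ P_{k,n}(θ)·A_d(θ) dθ`.
[cite: AlbrechtEtAl2020QuantumSieves, §5 p. 596, eq. (5)] -/
def falseNegativeRate (d k n : ℕ) (φ : ℝ) : ℝ :=
  1 - passProbUpTo d k n φ / capRatio d φ

/-- `P_{k,n}(0) = 1`: at angle `0` no hyperplane separates the pair ("`popcount_{k,n}(u,v;h) = 0` if no more than `k` of the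
hyperplanes separate `u` and `v`", with separation probability `θ/π = 0`). [cite: AlbrechtEtAl2020QuantumSieves, §5 p. 596] -/
theorem popcountPass_zero (k n : ℕ) : popcountPass k n 0 = 1 := by
  unfold popcountPass
  rw [Finset.sum_eq_single 0]
  · simp
  · intro i _ hi
    simp [zero_pow hi]
  · simp

/-- `0 ≤ P_{k,n}(θ)` for `0 ≤ θ ≤ π`: the printed `P_{k,n}` is a probability ("Let `P_{k,n}(u,v)` be the probability that
`popcount_{k,n}(u,v;h) = 0`"); here from the display, a sum of nonnegative terms. [cite: AlbrechtEtAl2020QuantumSieves, §5 p. 596] -/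
theorem popcountPass_nonneg (k n : ℕ) {θ : ℝ} (h0 : 0 ≤ θ) (hπ : θ ≤ Real.pi) : 0 ≤ popcountPass k n θ := by
  unfold popcountPass
  have hp : 0 ≤ θ / Real.pi := div_nonneg h0 Real.pi_pos.le
  have hq : 0 ≤ 1 - θ / Real.pi := by rw [sub_nonneg, div_le_one Real.pi_pos]; exact hπ
  exact Finset.sum_nonneg fun i _ => by positivity

/-- `P_{k,n}(θ) ≤ 1` for `0 ≤ θ ≤ π`: the printed `P_{k,n}` is a probability; here from the display, the partial binomial sum is at
most `(θ/π + (1 − θ/π))^n = 1`. [cite: AlbrechtEtAl2020QuantumSieves, §5 p. 596] -/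
theorem popcountPass_le_one (k n : ℕ) {θ : ℝ} (h0 : 0 ≤ θ) (hπ : θ ≤ Real.pi) : popcountPass k n θ ≤ 1 := by
  unfold popcountPass
  have hp : 0 ≤ θ / Real.pi := div_nonneg h0 Real.pi_pos.le
  have hq : 0 ≤ 1 - θ / Real.pi := by rw [sub_nonneg, div_le_one Real.pi_pos]; exact hπ
  have hfull : ∑ i ∈ range (n + 1), (n.choose i : ℝ) * (θ / Real.pi) ^ i * (1 - θ / Real.pi) ^ (n - i) = 1 := by
    have h := add_pow (θ / Real.pi) (1 - θ / Real.pi) n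
    rw [show θ / Real.pi + (1 - θ / Real.pi) = 1 by ring, one_pow] at h
    calc ∑ i ∈ range (n + 1), (n.choose i : ℝ) * (θ / Real.pi) ^ i * (1 - θ / Real.pi) ^ (n - i)
        = ∑ m ∈ range (n + 1), (θ / Real.pi) ^ m * (1 - θ / Real.pi) ^ (n - m) * (n.choose m : ℝ) :=
          Finset.sum_congr rfl fun i _ => by ring
      _ = 1 := h.symm
  have hterm : ∀ i, 0 ≤ (n.choose i : ℝ) * (θ / Real.pi) ^ i * (1 - θ / Real.pi) ^ (n - i) := fun i => by positivity
  by_cases hk : k ≤ n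
  · exact (Finset.sum_le_sum_of_subset_of_nonneg (Finset.range_mono (Nat.succ_le_succ hk)) fun i _ _ => hterm i).trans_eq
      hfull
  · -- `k > n`: the extra terms `i > n` vanish (`C(n,i) = 0`)
    have e : ∑ i ∈ range (k + 1), (n.choose i : ℝ) * (θ / Real.pi) ^ i * (1 - θ / Real.pi) ^ (n - i) =
        ∑ i ∈ range (n + 1), (n.choose i : ℝ) * (θ / Real.pi) ^ i * (1 - θ / Real.pi) ^ (n - i) := by
      rw [← Finset.sum_subset (Finset.range_mono (show n + 1 ≤ k + 1 by omega))]
      intro i hi hin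
      simp only [Finset.mem_range, not_lt] at hi hin
      rw [Nat.choose_eq_zero_of_lt (by omega)]
      simp
    rw [e, hfull]

end Literature.Computability.Cryptography.AGPS20

end
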